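import Summits.Ventures.YMGap.RobustBall.StarDoorZdGeometric
import Summits.Ventures.YMGap.RobustBall.DirectionalSusceptibilityS
import HarnessLib

/-!
# Venture YMGap, track ROBUST-BALL (Y2) — THROUGH THE STAR DOOR: the static susceptibility of every local observable against every direction
# is an absolutely convergent series, for every tier-1 member with a star window bound (the `SU(2)` Wilson point up to `β_W = 1/3`)

HONEST FRAMING. WHAT THIS IS: a venture file (cell `pub-ymgap`, track Y2 ROBUST-BALL, seat rb-p1, theorems only): the STAR-DOOR twin of
`DirectionalSusceptibilityS.lean`.  Member `(W, supp)`: continuous own-link terms of range `R`, a star window bound with locality radius `D ≥ R + 2`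
and received sum `0 ≤ ρ < 1`; ANY DLR state `μ`; direction `V` = link potential with measurable bounded own-link terms and Frobenius-Lipschitz
witnesses of total load `Σ'_{X ∋ e} Σ_{y ∈ X} lipV_X(y) ≤ L` through every link.
* `pow_floor_le_exp` — `ρ^{⌊x/(D+2)⌋} ≤ (1/ρ')·e^{−(log(1/ρ')/(D+2))·x}`, `ρ' = max(ρ, ½)`;
* ★ `summable_abs_cov_direction_star` — `X ↦ |cov_μ(f, V_X)|` is summable over ALL finite link sets and
  `Σ_X |cov_μ(f, V_X)| ≤ 2(2√N)² (Σ_{Δf} δf) · (1/ρ') · L · #Δf · d · ((1+q)/(1−q))^d`, `q = e^{−t'/d}`, `t' = log(1/ρ')/(D+2)` — one constant for every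
  member with the same star data and every DLR state;
* `su2_wilson_summable_abs_cov_direction_upTo_oneThird` — `SU(2)`, `ℤ⁴`, the Wilson point for EVERY `0 ≤ β_W ≤ 1/3` (received sum `≤ 399/400`, `D = 3`):
  finite static susceptibility of every Lipschitz cylinder against every direction of finite Lipschitz load.
WHAT THIS IS NOT: the derivative statement through the star door (needs the star twin of `TruncationConvergenceS`/`StateDerivativeOnBallS`, not yet
written); one-sided Dobrushin–Shlosman comparison constants; lattice strong coupling only; nothing about the continuum limit or a Clay-sense mass gap.
-/

noncomputable section

open MeasureTheory Function Finset ProbabilityTheory Real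
open scoped NNReal
open Literature.Probability.LatticeModels
open Literature.Probability.LatticeModels.DobrushinMetric
open Literature.MathematicalPhysics.QuantumLattice
open Literature.MathematicalPhysics.QuantumFieldTheory hiding ZdEdge
open Literature.MathematicalPhysics.QuantumFieldTheory.Balaban1983to89.StrongCouplingDobrushinWindow (OneLinkKRModulus)
open Summit.Ventures.YMGap.DSWindowZd
open Summit.Ventures.YMGap.StarResolventDim (gaugeR doorPoly Delta)

namespace Summit.Ventures.YMGap.RobustBall

variable {d N : ℕ}

/-- `ρ^{⌊x/(D+2)⌋} ≤ (1/ρ')·e^{−(log(1/ρ')/(D+2))·x}` for `0 ≤ ρ < 1`, `ρ' = max(ρ,½)` (any real `x`; `⌊·⌋₊` truncates). -/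
theorem pow_floor_le_exp {ρ x : ℝ} (hρ0 : 0 ≤ ρ) (hρ1 : ρ < 1) (D : ℕ) :
    ρ ^ ⌊x / (D + 2 : ℕ)⌋₊ ≤ (max ρ (1 / 2))⁻¹ * exp (-(-Real.log (max ρ (1 / 2)) / (D + 2 : ℕ)) * x) := by
  set ρ' : ℝ := max ρ (1 / 2) with hρ'
  have hρ'0 : 0 < ρ' := lt_of_lt_of_le (by norm_num) (le_max_right _ _)
  have hρ'1 : ρ' < 1 := max_lt hρ1 (by norm_num)
  have hρρ' : ρ ≤ ρ' := le_max_left _ _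
  have hD2 : (0 : ℝ) < (D + 2 : ℕ) := by positivity
  set n : ℕ := ⌊x / (D + 2 : ℕ)⌋₊ with hn
  have h1 : ρ ^ n ≤ ρ' ^ n := pow_le_pow_left₀ hρ0 hρρ' n
  -- `ρ'^n = e^{n log ρ'} ≤ e^{(x/(D+2) − 1) log ρ'}` since `n ≥ x/(D+2) − 1` and `log ρ' ≤ 0`
  have hlog : Real.log ρ' ≤ 0 := Real.log_nonpos hρ'0.le hρ'1.le
  have hn1 : x / (D + 2 : ℕ) - 1 ≤ (n : ℝ) := by
    have := Nat.lt_floor_add_one (x / (D + 2 : ℕ)); rw [← hn] at this; push_cast at this ⊢; linarith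
  have h2 : ρ' ^ n = exp ((n : ℝ) * Real.log ρ') := by rw [← Real.exp_log (pow_pos hρ'0 n), Real.log_pow]
  have h3 : (n : ℝ) * Real.log ρ' ≤ (x / (D + 2 : ℕ) - 1) * Real.log ρ' := mul_le_mul_of_nonpos_right hn1 hlog
  have h4 : exp ((x / (D + 2 : ℕ) - 1) * Real.log ρ') = ρ'⁻¹ * exp (-(-Real.log ρ' / (D + 2 : ℕ)) * x) := by
    rw [show (x / (D + 2 : ℕ) - 1) * Real.log ρ' = -(-Real.log ρ' / (D + 2 : ℕ)) * x + -Real.log ρ' by field_simp; ring,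
      Real.exp_add, Real.exp_neg, Real.exp_log hρ'0, mul_comm]
  calc ρ ^ n ≤ ρ' ^ n := h1
    _ = exp ((n : ℝ) * Real.log ρ') := h2
    _ ≤ exp ((x / (D + 2 : ℕ) - 1) * Real.log ρ') := exp_le_exp.2 h3
    _ = ρ'⁻¹ * exp (-(-Real.log ρ' / (D + 2 : ℕ)) * x) := h4

section Star

variable {W V : Potential (ZdEdge d) (SUN N)} {supp : Finset (ZdEdge d) → Finset (Finset (ZdEdge d))}

/-- ★ **THROUGH THE STAR DOOR, THE SUSCEPTIBILITY SERIES CONVERGES ABSOLUTELY.**  Member `(W, supp)` (continuous own-link terms of range `R`,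
star window bound with locality radius `D ≥ R + 2`, received sum `0 ≤ ρ < 1`), ANY DLR state `μ`; observable `f` (bounded measurable, local on
`Δf`, Frobenius-Lipschitz vector `δf`); direction `V` (measurable bounded own-link terms, Frobenius-Lipschitz witnesses of total load `≤ L` through
every link).  With `ρ' = max(ρ,½)`, `t' = log(1/ρ')/(D+2)`, `q = e^{−t'/d}`:
`Σ_X |cov_μ(f, V_X)| ≤ 2(2√N)²(Σ_{Δf} δf)·ρ'⁻¹·L·#Δf·d·((1+q)/(1−q))^d`, and the series is summable. -/
theorem summable_abs_cov_direction_star (hd : 1 ≤ d) {β ρ : ℝ} {R D : ℕ}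
    (hWc : ∀ X, Continuous (W X)) (hWdep : ∀ X, DependsOn (W X) (↑X : Set (ZdEdge d))) (hsupp : W.IsSupportedBy supp)
    (hR : ∀ e, ∀ X ∈ supp {e}, e ∈ X → ∀ y ∈ X, ‖e.1 - y.1‖ ≤ (R : ℝ)) (hD : R + 2 ≤ D) (hρ0 : 0 ≤ ρ) (hρ1 : ρ < 1)
    (h : StarWindowBoundZdR d N (perturbedYM (d := d) (fundamentalRep (Fin N)) (N * β) W supp) D ρ suFrobDist)
    {μ : Measure (LGConfig d (SUN N))} (hμ : μ ∈ perturbedGibbsMeasures (d := d) (fundamentalRep (Fin N)) (N * β) W supp)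
    {f : LGConfig d (SUN N) → ℝ} (hfm : Measurable f) {Δf : Finset (ZdEdge d)} (hfdep : DependsOn f (↑Δf : Set (ZdEdge d)))
    {Mf : ℝ} (hMf : ∀ σ, |f σ| ≤ Mf) {δf : ZdEdge d → ℝ} (hδf : IsLipBound suFrobDist f δf)
    (hVm : ∀ X, Measurable (V X)) (hVdep : ∀ X, DependsOn (V X) (↑X : Set (ZdEdge d))) (hVb : ∀ X, ∃ C, ∀ U, |V X U| ≤ C)
    {lipV : Finset (ZdEdge d) → ZdEdge d → ℝ} (hlipV : ∀ X, IsLipBound suFrobDist (V X) (lipV X)) {L : ℝ}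
    (hLs : ∀ e, Summable fun X : Finset (ZdEdge d) => (if e ∈ X then ∑ y ∈ X, lipV X y else 0))
    (hL : ∀ e, ∑' X : Finset (ZdEdge d), (if e ∈ X then ∑ y ∈ X, lipV X y else 0) ≤ L) :
    Summable (fun X : Finset (ZdEdge d) => |cov[f, V X; μ]|) ∧
      ∑' X : Finset (ZdEdge d), |cov[f, V X; μ]| ≤ 2 * (2 * Real.sqrt N) ^ 2 * (∑ y ∈ Δf, δf y) * (max ρ (1 / 2))⁻¹ * L *
        (Δf.card * (d * ((1 + exp (-(-Real.log (max ρ (1 / 2)) / (D + 2 : ℕ) / d))) /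
          (1 - exp (-(-Real.log (max ρ (1 / 2)) / (D + 2 : ℕ) / d)))) ^ d)) := by
  classical
  haveI : SecondCountableTopology (Matrix (Fin N) (Fin N) ℂ) :=
    inferInstanceAs (SecondCountableTopology (Fin N → Fin N → ℂ))
  haveI : SecondCountableTopology (SUN N) := Topology.IsEmbedding.subtypeVal.secondCountableTopology
  have hW : W.IsAdapted := fun X => ⟨hWdep X, (hWc X).measurable⟩
  have hWb : ∀ X, ∃ C, ∀ U, |W X U| ≤ C := fun X => exists_bound_of_continuous (hWc X)
  have hγ : IsSpecification (perturbedYM (d := d) (fundamentalRep (Fin N)) (N * β) W supp) :=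
    isSpecification_perturbedYM _ (continuous_fundamentalRep (Fin N)) _ hW hWb hsupp
  have hμ' : IsGibbsMeasure (perturbedYM (d := d) (fundamentalRep (Fin N)) (N * β) W supp) μ := hμ
  have hD1 : 1 ≤ D := by omega
  have hloc : ∀ (c : ZdEdge d) (ζ ζ' : LGConfig d (SUN N)), (∀ v ∈ starNbhdZdR D c.1, ζ v = ζ' v) →
      ∀ (g : LGConfig d (SUN N) → ℝ), Measurable g → (∃ B, ∀ σ, |g σ| ≤ B) →
        DependsOn g (starWinZd c : Set (ZdEdge d)) →
        ∫ σ, g σ ∂(perturbedYM (d := d) (fundamentalRep (Fin N)) (N * β) W supp (starWinZd c) ζ) =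
          ∫ σ, g σ ∂(perturbedYM (d := d) (fundamentalRep (Fin N)) (N * β) W supp (starWinZd c) ζ') :=
    fun c ζ ζ' hζ g hgm _ hgdep => perturbed_star_hloc _ (continuous_fundamentalRep (Fin N)) _
      (fun X => (hWc X).measurable) hWdep hsupp hR hD c ζ ζ' hζ g hgm hgdep
  -- the rate and the majorant
  set ρ' : ℝ := max ρ (1 / 2) with hρ'
  have hρ'0 : 0 < ρ' := lt_of_lt_of_le (by norm_num) (le_max_right _ _)
  have hρ'1 : ρ' < 1 := max_lt hρ1 (by norm_num)
  set t : ℝ := -Real.log ρ' / (D + 2 : ℕ) with ht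
  have hlogneg : 0 < -Real.log ρ' := by have := Real.log_neg hρ'0 hρ'1; linarith
  have htpos : 0 < t := div_pos hlogneg (by positivity)
  set A₀ : ℝ := 2 * (2 * Real.sqrt N) ^ 2 * (∑ y ∈ Δf, δf y) * ρ'⁻¹ with hA₀
  set LX : Finset (ZdEdge d) → ℝ := fun X => ∑ y ∈ X, lipV X y with hLXdef
  set g₀ : ZdEdge d → ℝ := fun e => exp (-t * linkSetDist Δf e) with hg₀
  have hδ0 : 0 ≤ ∑ y ∈ Δf, δf y := sum_nonneg fun y _ => hδf.nonneg y
  have hA₀0 : 0 ≤ A₀ := by positivity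
  have hLX0 : ∀ X, 0 ≤ LX X := fun X => sum_nonneg fun y _ => (hlipV X).nonneg y
  have hg00 : ∀ e, 0 ≤ g₀ e := fun e => (exp_pos _).le
  have hd0 : 0 < d := hd
  have hL0 : 0 ≤ L := le_trans (tsum_nonneg fun X => by split_ifs; exacts [hLX0 X, le_rfl]) (hL (0, ⟨0, hd0⟩))
  -- termwise: the star door's bound, the floor power dominated by the exponential, then the summable profile
  have hterm : ∀ X, |cov[f, V X; μ]| ≤ A₀ * LX X * ∑ e ∈ X, g₀ e := fun X => by
    obtain ⟨CX, hCX⟩ := hVb X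
    have h1 := abs_covariance_le_of_starWindowBoundZdR_geometric hγ hD1 hloc hρ0 hρ1 h hμ' hfm (hVm X) hMf hCX hfdep (hVdep X) hδf
      (hlipV X)
    have h2 : |cov[f, V X; μ]| ≤ A₀ * LX X * exp (-(t * setDistEdges Δf X)) := by
      refine h1.trans ?_
      have hp := pow_floor_le_exp (x := setDistEdges Δf X) hρ0 hρ1 D
      calc 2 * (2 * Real.sqrt N) ^ 2 * ρ ^ ⌊setDistEdges Δf X / (D + 2 : ℕ)⌋₊ * (∑ x ∈ Δf, δf x) * ∑ y ∈ X, lipV X y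
          ≤ 2 * (2 * Real.sqrt N) ^ 2 * (ρ'⁻¹ * exp (-(-Real.log ρ' / (D + 2 : ℕ)) * setDistEdges Δf X)) * (∑ x ∈ Δf, δf x) *
              ∑ y ∈ X, lipV X y := by gcongr; exact hLX0 X
        _ = A₀ * LX X * exp (-(t * setDistEdges Δf X)) := by simp only [hA₀, hLXdef, ht, neg_mul]; ring
    refine le_mul_sum_exp_of_le_mul_exp htpos.le hA₀0 (hLX0 X) h2 (fun hX => ?_) (fun hΔ => ?_)
    · simp only [hLXdef, Finset.not_nonempty_iff_eq_empty.1 hX, sum_empty]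
    · simp only [hA₀, Finset.not_nonempty_iff_eq_empty.1 hΔ, sum_empty, mul_zero, zero_mul]
  have hpartial : ∀ T : Finset (Finset (ZdEdge d)), ∑ X ∈ T, |cov[f, V X; μ]| ≤
      A₀ * L * (Δf.card * (d * ((1 + exp (-(t / d))) / (1 - exp (-(t / d)))) ^ d)) := by
    intro T
    have h1 : ∑ X ∈ T, |cov[f, V X; μ]| ≤ A₀ * ∑ X ∈ T, LX X * ∑ e ∈ X, g₀ e := by
      rw [mul_sum]; exact sum_le_sum fun X _ => (hterm X).trans (le_of_eq (by ring))
    refine h1.trans ?_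
    by_cases hΔ : Δf.Nonempty
    · obtain ⟨hgs, hgt⟩ := summable_exp_neg_linkSetDist hd htpos hΔ
      calc A₀ * ∑ X ∈ T, LX X * ∑ e ∈ X, g₀ e
          ≤ A₀ * (L * (Δf.card * (d * ((1 + exp (-(t / d))) / (1 - exp (-(t / d)))) ^ d))) :=
            mul_le_mul_of_nonneg_left ((sum_mul_sum_le_of_load hg00 hgs hLX0 hL0 hLs hL).trans (mul_le_mul_of_nonneg_left hgt hL0)) hA₀0
        _ = _ := by ring
    · have hA00 : A₀ = 0 := by simp only [hA₀, Finset.not_nonempty_iff_eq_empty.1 hΔ, sum_empty, mul_zero, zero_mul]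
      rw [hA00, zero_mul, zero_mul, zero_mul]
  exact ⟨summable_of_sum_le (fun _ => abs_nonneg _) hpartial, Real.tsum_le_of_sum_le (fun _ => abs_nonneg _) hpartial⟩

end Star

/-! ### `SU(2)`, `ℤ⁴`: the Wilson point up to `β_W = 1/3` -/

/-- **THE `SU(2)` WILSON POINT ON `ℤ⁴`, EVERY `0 ≤ β_W ≤ 1/3`: FINITE STATIC SUSCEPTIBILITY OF EVERY LIPSCHITZ CYLINDER AGAINST EVERY DIRECTION OF
FINITE LIPSCHITZ LOAD** (received sum `≤ 399/400` along the segment, star radius `D = 3`): for every DLR `μ` and every direction `V` with total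
Lipschitz load `≤ L`, `X ↦ |cov_μ(F, V_X)|` is summable. -/
theorem su2_wilson_summable_abs_cov_direction_upTo_oneThird {βW : ℝ} (h0 : 0 ≤ βW) (h1 : βW ≤ 1 / 3)
    {μ : Measure (LGConfig 4 (SUN 2))} (hμ : μ ∈ ymGibbsMeasures (d := 4) (fundamentalRep (Fin 2)) (2 * (βW / 4)))
    {F : LGConfig 4 (SUN 2) → ℝ} {ΛF : Finset (ZdEdge 4)} {KF : ℝ≥0} (hF : IsLipschitzCylinder (fundamentalRep (Fin 2)) F ΛF KF)
    {V : Potential (ZdEdge 4) (SUN 2)} (hVm : ∀ X, Measurable (V X)) (hVdep : ∀ X, DependsOn (V X) (↑X : Set (ZdEdge 4)))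
    (hVb : ∀ X, ∃ C, ∀ U, |V X U| ≤ C)
    {lipV : Finset (ZdEdge 4) → ZdEdge 4 → ℝ} (hlipV : ∀ X, IsLipBound suFrobDist (V X) (lipV X)) {L : ℝ}
    (hLs : ∀ e, Summable fun X : Finset (ZdEdge 4) => (if e ∈ X then ∑ y ∈ X, lipV X y else 0))
    (hL : ∀ e, ∑' X : Finset (ZdEdge 4), (if e ∈ X then ∑ y ∈ X, lipV X y else 0) ≤ L) :
    Summable (fun X : Finset (ZdEdge 4) => |cov[F, V X; μ]|) := by
  -- the zero member of `MemBallZdG (3/125) (3/250) 0` and its star window bound at received sum `≤ 399/400`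
  have hmem : MemBallZdG (N := 2) (d := 4) (3 / 125) (3 / 250) 0 0 (fun _ => (∅ : Finset (Finset (ZdEdge 4)))) :=
    memBallZdG_zero (by norm_num) (by norm_num) 0
  have habs : |((2 : ℕ) : ℝ) * (βW / 4)| / ((2 : ℕ) : ℝ) = βW / 4 := by
    rw [abs_of_nonneg (by positivity)]; push_cast; ring
  have hR : |((2 : ℕ) : ℝ) * (βW / 4)| / ((2 : ℕ) : ℝ) * (2 * (((4 : ℕ) : ℝ) - 1)) ≤ 3 * βW / 2 := by
    rw [habs]; push_cast; linarith
  have hc' : (1 : ℝ) * Real.exp (3 / 125) * (1 + 2 * Real.sqrt ((2 : ℕ) : ℝ) * (3 / 250)) *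
      (|((2 : ℕ) : ℝ) * (βW / 4)| / ((2 : ℕ) : ℝ)) ≤ 17651 / 200000 := by
    have h2 : Real.sqrt ((2 : ℕ) : ℝ) = Real.sqrt 2 := by norm_num
    rw [h2, one_mul, habs]
    have hb : 0 ≤ βW / 4 := by positivity
    calc Real.exp (3 / 125) * (1 + 2 * Real.sqrt 2 * (3 / 250)) * (βW / 4)
        ≤ 1024291 / 1000000 * (1 + 2 * 1.41422 * (3 / 250)) * ((1 / 3) / 4) := by
          gcongr
          · exact exp_le_3_125_star
          · exact sqrt_two_le
      _ ≤ 17651 / 200000 := by norm_num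
  have hlam' : Real.sqrt ((2 : ℕ) : ℝ) * (3 / 250 : ℝ) ≤ 16971 / 1000000 := by
    have h2 : Real.sqrt ((2 : ℕ) : ℝ) = Real.sqrt 2 := by norm_num
    rw [h2]; nlinarith [sqrt_two_le, Real.sqrt_nonneg 2]
  have hwin := (starWindowBoundZdR_of_memBallZdG (d := 4) (N := 2) (by norm_num) (by norm_num) zero_le_one hR
    (su2_quarterModulus (h1.trans (by norm_num))) (by norm_num) hc' hlam' (θ := 6 * (17651 / 200000) + 16971 / 1000000)
    (by push_cast; ring) (by norm_num) (by unfold doorPoly; norm_num) (Kn := 20)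
    (ρ := gaugeR 4 (17651 / 200000) + (16971 / 1000000 + (6 * (17651 / 200000) + 16971 / 1000000) ^ 20 * (4 * 4 * (16971 / 1000000))) /
      (1 - (6 * (17651 / 200000) + 16971 / 1000000))) (by push_cast; ring) hmem).mono_rho
    (show _ ≤ (399 / 400 : ℝ) by unfold gaugeR Delta; norm_num)
  have hμ' : μ ∈ perturbedGibbsMeasures (d := 4) (fundamentalRep (Fin 2)) ((2 : ℕ) * (βW / 4))
      (0 : Potential (ZdEdge 4) (SUN 2)) (fun _ => ∅) := by
    rw [perturbedGibbsMeasures_zero]; exact_mod_cast hμ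
  have hA : ∀ a b : SUN 2, dist (suEntries a) (suEntries b) ≤ 1 * suFrobDist a b :=
    fun a b => by rw [one_mul]; exact dist_suEntries_le_suFrobDist a b
  exact (summable_abs_cov_direction_star (N := 2) (d := 4) (by norm_num) hmem.continuous hmem.dependsOn hmem.supportedBy hmem.range
    (show 0 + 2 ≤ max 0 1 + 2 by norm_num) (by norm_num) (by norm_num) hwin hμ' hF.measurable hF.dependsOn hF.abs_le
    (hF.isLipBound zero_le_one hA) hVm hVdep hVb hlipV hLs hL).1

end Summit.Ventures.YMGap.RobustBall

end
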